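import Mathlib
import Literature.Analysis.FluidPDE.Tao2016AveragedNS.RenormalisedCascadeWaves

/-!
# Crux `TaoLadderRungTwoBreak.NoSurvivingEternalViscBddOne` (stmt-NavierStokesRegularity-20419), remaining lemma (W1):
# the KOLMOGOROV INVARIANT of the continuum limit of the positive dyadic lattice (kernel anchor for the W1 memo)

MODEL/heuristic layer only; nothing here is a statement about the Navier–Stokes equations or about the lattice items —
it certifies the one-line calculus fact on which the (W1) proof architecture (census v7, W1 memo attached to ⟨20419⟩) rests.

As the scale ratio tends to one (`h = log Λ → 0`, `y = n h`, `τ = h t`) the positive dyadic lattice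
`Ė_n = F_{n-1} − F_n`, `F_n = 2Λ^n E_n E_{n+1}^{1/2}`, is a conservative three-point scheme for the scalar conservation law
`∂_τ E + ∂_y f(y,E) = 0` with flux `f(y,E) = 2 e^{y} E^{3/2}`.  Its characteristic system is
`dy/dτ = ∂_E f = 3 e^{y} E^{1/2}`, `dE/dτ = −∂_y f = −2 e^{y} E^{3/2}`, and along it

  `E · e^{2y/3}` is constant      (`kolmogorov_invariant_hasDerivAt`, `kolmogorov_invariant_const`)

— Kolmogorov's law `E ∝ e^{−2y/3} = Λ^{−2n/3}` for the energy STRANDED behind a blow-up front, i.e. wake rate `2/3` in `y`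
against the (S₁)-survival threshold `2/5` (`E_n ≍ (1+ε₀)^{−n} = Λ^{−2n/5}`): an O(1) gap in the exponential rate, which is
what a convergence theorem lattice → entropy solutions (W1a) has to preserve.  See the memo for the architecture and caveats
(the scheme is conservative but not monotone; ancient solutions; uniformity over the class).

HONEST LABEL: elementary calculus (product/chain rule); records the mechanism, proves nothing about any item.
-/

noncomputable section

-- the summit and its single sub-problem share the name (CONVENTIONS §1)
set_option linter.dupNamespace false

namespace Summit.NavierStokesRegularity.NavierStokesRegularity.Theorems.NoSurvivingEternalViscBddOne.Continuum

open Real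

/-- **The Kolmogorov invariant along characteristics.**  If `y' = 3e^{y}√E` and `E' = −2e^{y}E√E` at `τ` (the
characteristic system of `∂_τE + ∂_y(2e^{y}E^{3/2}) = 0`), then `τ ↦ E(τ)·e^{(2/3)y(τ)}` has derivative `0` at `τ`.
[folklore (method of characteristics); cell memo W1] -/
theorem kolmogorov_invariant_hasDerivAt {y E : ℝ → ℝ} {τ : ℝ}
    (hy : HasDerivAt y (3 * exp (y τ) * sqrt (E τ)) τ)
    (hE : HasDerivAt E (-2 * exp (y τ) * E τ * sqrt (E τ)) τ) :
    HasDerivAt (fun s => E s * exp (2 / 3 * y s)) 0 τ := by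
  have h1 : HasDerivAt (fun s => exp (2 / 3 * y s)) (exp (2 / 3 * y τ) * (2 / 3 * (3 * exp (y τ) * sqrt (E τ)))) τ :=
    (hy.const_mul (2 / 3)).exp
  have h2 := hE.mul h1
  refine h2.congr_deriv ?_
  ring

/-- Hence `E·e^{2y/3}` is CONSTANT along every global characteristic: the energy deposited at height `y` by a
characteristic launched with `(y₀, E₀)` is `E₀ e^{−2(y−y₀)/3}` — Kolmogorov's `−2/3` law in `y = n log Λ` (`= Λ^{−2n/3}`,
`= (1+ε₀)^{−5n/3}` per shell), steeper than the (S₁) threshold `e^{−2y/5}`.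
[folklore (method of characteristics); cell memo W1] -/
theorem kolmogorov_invariant_const {y E : ℝ → ℝ}
    (hy : ∀ τ, HasDerivAt y (3 * exp (y τ) * sqrt (E τ)) τ)
    (hE : ∀ τ, HasDerivAt E (-2 * exp (y τ) * E τ * sqrt (E τ)) τ) (τ₁ τ₂ : ℝ) :
    E τ₁ * exp (2 / 3 * y τ₁) = E τ₂ * exp (2 / 3 * y τ₂) :=
  is_const_of_deriv_eq_zero
    (fun τ => (kolmogorov_invariant_hasDerivAt (hy τ) (hE τ)).differentiableAt)
    (fun τ => (kolmogorov_invariant_hasDerivAt (hy τ) (hE τ)).deriv) τ₁ τ₂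

/-- The rate comparison behind (W1): in the height variable `y = n log Λ`, `Λ = (1+ε₀)^{5/2}`, the Kolmogorov wake
`Λ^{−2n/3}` equals `(1+ε₀)^{−(5/3)n}` while the (S₁) threshold `(1+ε₀)^{−n}` equals `Λ^{−2n/5}`; `5/3 > 1`
(equivalently `2/3 > 2/5`): `((1+ε₀)^{5/2})^{2/3} = (1+ε₀)^{5/3}` and `(1+ε₀)^{5/3} > (1+ε₀)^{1}` for `ε₀ > 0`.
[elementary] -/
theorem kolmogorov_rate_exceeds_threshold {ε₀ : ℝ} (hε : 0 < ε₀) :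
    ((1 + ε₀) ^ ((5 : ℝ) / 2)) ^ ((2 : ℝ) / 3) = (1 + ε₀) ^ ((5 : ℝ) / 3) ∧
      (1 + ε₀) ^ (1 : ℝ) < (1 + ε₀) ^ ((5 : ℝ) / 3) := by
  have h1 : (0 : ℝ) ≤ 1 + ε₀ := by linarith
  refine ⟨?_, ?_⟩
  · rw [← Real.rpow_mul h1]; norm_num
  · exact Real.rpow_lt_rpow_of_exponent_lt (by linarith) (by norm_num)


section SonicSelection

open Filter Topology Set

/-! ## Sonic (second-kind) selection of the similarity exponent of continuum blow-up fronts

In the blow-up variables `s = -log(t⋆ - τ)` the conservation law `∂_τ E + ∂_y(2e^{y}E^{3/2}) = 0` of the continuum limit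
admits the similarity class `E = (t⋆-τ)^{a} G(η)`, `η = y + b log(t⋆-τ)` (front receding to `y = +∞` like
`-b log(t⋆-τ)`), exactly when `b = 1 + a/2` (flux balance) and the profile solves the steady conservative equation
`(2e^{η} G^{3/2} - b G)' = a G`.  Its non-conservative form is `(3e^{η}√G - b) G' = aG - 2e^{η}G^{3/2}`: the coefficient
of `G'` vanishes on the SONIC line `3e^{η}√G = b` (characteristic speed = frame speed).  A `C¹` profile crossing the
sonic line must have `aG = 2e^{η}G^{3/2} = (2b/3)G` there, i.e. `a = 2b/3`; with `b = 1 + a/2` this pins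
`(a, b) = (1, 3/2)` and the wake rate `γ = a/b = 2/3` (Kolmogorov), against the (S₁) threshold `2/5`.  Behind the leading
shock the Rankine–Hugoniot state is supersonic (`3e^{η}√G = 3b/2 > b`), and a wake decaying like `e^{-γη}`, `γ < 2`,
is eventually subsonic, so the crossing — hence the selection — is forced for shock-free wakes (self-similarity of the
second kind, Barenblatt 1979 Ch. 4; Guderley; the same transonic matching appears in route WakeRatchet's asymptotics for
item 21808, module `WakeRatchetTailRatchetUniformFrontRH`).  READING FOR (W1): the Kolmogorov invariant above holds along
each characteristic, but the terminal wake PROFILE across characteristics is fixed only by the similarity exponents of the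
ancient front, and those are selected by regularity at the sonic point — a lattice convergence/rigidity theorem for (W1)
has to reproduce this selecting mechanism (regularity of the renormalised profile across the shell where the local transfer
speed equals the front speed); an (S₁)-surviving continuum front would need the non-selected exponents `a ≤ 1/2`.
Appended by leafhand 4-g9 (section `SonicSelection`).  MODEL/heuristic layer: elementary calculus about the continuum
limit, nothing about the lattice items or about Navier–Stokes. -/

/-- **Non-conservative form of the steady profile equation.**  If the conservative profile equation
`(2e^{η}G√G - bG)' = aG` holds at `η₀` (as a derivative of the flux-minus-frame-transport) and the profile is
differentiable there with `G(η₀) > 0`, `G'(η₀) = g`, then `(3e^{η₀}√G(η₀) - b)·g = aG(η₀) - 2e^{η₀}G(η₀)√G(η₀)`.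
[folklore (self-similar solutions of the second kind, cf. Barenblatt 1979, Ch. 4); cell memo W1 (continuum limit of the positive dyadic lattice)] -/
theorem profile_nonconservative {G : ℝ → ℝ} {a b g η₀ : ℝ} (hG : HasDerivAt G g η₀) (hpos : 0 < G η₀)
    (hΦ : HasDerivAt (fun η => 2 * exp η * (G η * sqrt (G η)) - b * G η) (a * G η₀) η₀) :
    (3 * exp η₀ * sqrt (G η₀) - b) * g = a * G η₀ - 2 * exp η₀ * (G η₀ * sqrt (G η₀)) := by
  have hsq : HasDerivAt (fun η => sqrt (G η)) (g / (2 * sqrt (G η₀))) η₀ := hG.sqrt hpos.ne'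
  have hGs : HasDerivAt (fun η => G η * sqrt (G η)) (g * sqrt (G η₀) + G η₀ * (g / (2 * sqrt (G η₀)))) η₀ :=
    hG.mul hsq
  have hflux : HasDerivAt (fun η => 2 * exp η * (G η * sqrt (G η)))
      (2 * exp η₀ * (G η₀ * sqrt (G η₀)) +
        2 * exp η₀ * (g * sqrt (G η₀) + G η₀ * (g / (2 * sqrt (G η₀))))) η₀ := by
    have h2 : HasDerivAt (fun η => 2 * exp η) (2 * exp η₀) η₀ := (Real.hasDerivAt_exp η₀).const_mul 2
    exact h2.mul hGs
  have htot : HasDerivAt (fun η => 2 * exp η * (G η * sqrt (G η)) - b * G η)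
      (2 * exp η₀ * (G η₀ * sqrt (G η₀)) +
        2 * exp η₀ * (g * sqrt (G η₀) + G η₀ * (g / (2 * sqrt (G η₀)))) - b * g) η₀ :=
    hflux.sub (hG.const_mul b)
  have huniq := hΦ.unique htot
  have hs : 0 < sqrt (G η₀) := sqrt_pos.2 hpos
  have hss : sqrt (G η₀) * sqrt (G η₀) = G η₀ := mul_self_sqrt hpos.le
  have hkey : G η₀ * (g / (2 * sqrt (G η₀))) = sqrt (G η₀) * g / 2 := by
    field_simp
    rw [Real.sq_sqrt hpos.le]
    ring
  rw [hkey] at huniq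
  nlinarith [huniq, hss]

/-- **Sonic selection.**  At a SONIC point `3e^{η₀}√G(η₀) = b` of a differentiable profile with `G(η₀) > 0` obeying
the conservative profile equation, `a = 2b/3` (the right-hand side of the non-conservative form must vanish too).
[folklore (self-similar solutions of the second kind, cf. Barenblatt 1979, Ch. 4); cell memo W1] -/
theorem sonic_selection {G : ℝ → ℝ} {a b g η₀ : ℝ} (hG : HasDerivAt G g η₀) (hpos : 0 < G η₀)
    (hΦ : HasDerivAt (fun η => 2 * exp η * (G η * sqrt (G η)) - b * G η) (a * G η₀) η₀)
    (hsonic : 3 * exp η₀ * sqrt (G η₀) = b) : a = 2 * b / 3 := by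
  have h := profile_nonconservative hG hpos hΦ
  rw [hsonic, sub_self, zero_mul] at h
  -- `aG = 2e^{η₀}G√G = (2/3)(3e^{η₀}√G)G = (2b/3)G`
  have h2 : a * G η₀ = 2 * b / 3 * G η₀ := by
    have : 2 * exp η₀ * (G η₀ * sqrt (G η₀)) = 2 / 3 * (3 * exp η₀ * sqrt (G η₀)) * G η₀ := by ring
    rw [this, hsonic] at h
    linarith
  exact mul_right_cancel₀ hpos.ne' h2

/-- **The similarity exponents are pinned.**  Sonic selection `a = 2b/3` together with the flux balance `b = 1 + a/2` of
the similarity class gives `a = 1`, `b = 3/2`: front at `y_f = (3/2)s`, front energy `≍ (t⋆-τ)`, and wake rate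
`a/b = 2/3` in `y = n log Λ` — Kolmogorov's `E_n ≍ Λ^{-2n/3} = (1+ε₀)^{-5n/3}`.
[folklore (self-similar solutions of the second kind); cell memo W1] -/
theorem exponents_of_sonic_selection {a b : ℝ} (hsel : a = 2 * b / 3) (hbal : b = 1 + a / 2) :
    a = 1 ∧ b = 3 / 2 ∧ a / b = 2 / 3 := by
  have ha : a = 1 := by rw [hbal] at hsel; linarith
  have hb : b = 3 / 2 := by rw [hbal, ha]; norm_num
  exact ⟨ha, hb, by rw [ha, hb]; norm_num⟩

/-- **Wake rate versus survival for the whole similarity class.**  For `a > -2` and `b = 1 + a/2` the wake rate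
`γ = a/b = 2a/(a+2)` is at most the (S₁) threshold `2/5` iff `a ≤ 1/2`; the selected exponent `a = 1` gives
`γ = 2/3 > 2/5` (non-surviving), so an (S₁)-surviving continuum front would need the non-selected exponents `a ≤ 1/2`.
[elementary; cell memo W1] -/
theorem wake_rate_le_threshold_iff {a b : ℝ} (ha : -2 < a) (hbal : b = 1 + a / 2) :
    a / b ≤ 2 / 5 ↔ a ≤ 1 / 2 := by
  have hb : 0 < b := by rw [hbal]; linarith
  rw [div_le_iff₀ hb, hbal]
  constructor <;> intro h <;> linarith

/-- **Rankine–Hugoniot state behind the leading front is supersonic.**  Across the leading shock at `η_f` the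
conservative quantity `2e^{η}G√G - bG` is continuous; ahead of the front `G = 0`, so the state `G₋ > 0` just behind it
obeys `2e^{η_f}G₋√G₋ = bG₋`, whence `3e^{η_f}√G₋ = 3b/2 > b` (Lax: characteristics run into the front).
[folklore (Rankine–Hugoniot / Lax condition for a scalar conservation law); cell memo W1] -/
theorem front_state_supersonic {Gm b ηf : ℝ} (hGm : 0 < Gm) (hb : 0 < b)
    (hRH : 2 * exp ηf * (Gm * sqrt Gm) = b * Gm) :
    3 * exp ηf * sqrt Gm = 3 / 2 * b ∧ b < 3 * exp ηf * sqrt Gm := by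
  have h1 : 2 * exp ηf * sqrt Gm = b := by
    have h2 : (2 * exp ηf * sqrt Gm) * Gm = b * Gm := by rw [← hRH]; ring
    exact mul_right_cancel₀ hGm.ne' h2
  refine ⟨by linarith, by linarith⟩

/-- **A decaying wake is eventually subsonic.**  If `G ≤ C e^{-γη}` on `(-∞, η₁]` with `γ < 2`, then for every
`b > 0` there is `η₂ ≤ η₁` with `3e^{η}√G(η) < b` for all `η ≤ η₂` (the wake characteristics fall behind the frame:
stranded energy).
[elementary; cell memo W1] -/
theorem wake_eventually_subsonic {G : ℝ → ℝ} {C γ η₁ b : ℝ} (hC : 0 ≤ C) (hγ : γ < 2) (hb : 0 < b)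
    (hG : ∀ η, η ≤ η₁ → G η ≤ C * exp (-γ * η)) :
    ∃ η₂, η₂ ≤ η₁ ∧ ∀ η, η ≤ η₂ → 3 * exp η * sqrt (G η) < b := by
  -- the majorant `3√C e^{(1-γ/2)η}` tends to `0` at `-∞`
  have hrate : 0 < 1 - γ / 2 := by linarith
  have htend : Tendsto (fun η : ℝ => 3 * sqrt C * exp ((1 - γ / 2) * η)) atBot (𝓝 0) := by
    have h1 : Tendsto (fun η : ℝ => (1 - γ / 2) * η) atBot atBot :=
      Tendsto.const_mul_atBot hrate tendsto_id
    have h2 : Tendsto (fun η : ℝ => exp ((1 - γ / 2) * η)) atBot (𝓝 0) :=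
      Real.tendsto_exp_atBot.comp h1
    simpa using h2.const_mul (3 * sqrt C)
  have hev : ∀ᶠ η in atBot, 3 * sqrt C * exp ((1 - γ / 2) * η) < b :=
    (tendsto_order.1 htend).2 b hb
  obtain ⟨η₃, hη₃⟩ := Filter.eventually_atBot.1 hev
  refine ⟨min η₃ η₁, min_le_right _ _, fun η hη => ?_⟩
  have hη1 : η ≤ η₁ := hη.trans (min_le_right _ _)
  have hη3 : η ≤ η₃ := hη.trans (min_le_left _ _)
  have hGle := hG η hη1
  -- `√G ≤ √C e^{-γη/2}`
  have hsq : sqrt (G η) ≤ sqrt C * exp (-γ * η / 2) := by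
    have : C * exp (-γ * η) = (sqrt C * exp (-γ * η / 2)) ^ 2 := by
      rw [mul_pow, sq_sqrt hC, ← Real.exp_nat_mul]; congr 1; ring_nf
    calc sqrt (G η) ≤ sqrt (C * exp (-γ * η)) := Real.sqrt_le_sqrt hGle
      _ = sqrt C * exp (-γ * η / 2) := by
          rw [this, Real.sqrt_sq (by positivity)]
  calc 3 * exp η * sqrt (G η) ≤ 3 * exp η * (sqrt C * exp (-γ * η / 2)) := by
        exact mul_le_mul_of_nonneg_left hsq (by positivity)
    _ = 3 * sqrt C * exp ((1 - γ / 2) * η) := by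
        rw [show (1 - γ / 2) * η = η + -γ * η / 2 by ring, Real.exp_add]; ring
    _ < b := hη₃ η hη3

/-- **Existence of a sonic point** (intermediate value theorem): a continuous profile on `[η₂, η']` that is
subsonic at `η₂` and supersonic at `η'` is sonic somewhere in between.
[elementary; cell memo W1] -/
theorem exists_sonic_point {G : ℝ → ℝ} {b η₂ η' : ℝ} (hle : η₂ ≤ η') (hcont : ContinuousOn G (Icc η₂ η'))
    (hsub : 3 * exp η₂ * sqrt (G η₂) < b)
    (hsup : b < 3 * exp η' * sqrt (G η')) :
    ∃ η₀ ∈ Ioo η₂ η', 3 * exp η₀ * sqrt (G η₀) = b := by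
  have hc : ContinuousOn (fun η => 3 * exp η * sqrt (G η)) (Icc η₂ η') := by
    refine ContinuousOn.mul (Continuous.continuousOn (by fun_prop)) ?_
    exact hcont.sqrt
  have hmem : b ∈ Ioo (3 * exp η₂ * sqrt (G η₂)) (3 * exp η' * sqrt (G η')) := ⟨hsub, hsup⟩
  exact intermediate_value_Ioo hle hc hmem

/-- **The similarity ansatz reduces the conservation law to the steady profile equation (flux balance `b = 1 + a/2`).**
For `τ < 0` (blow-up at `τ = 0`) put `E(y,τ) = (-τ)^{a} G(y + b log(-τ))`.  If `b = 1 + a/2` and the profile is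
differentiable with `G > 0` at `η₀ = y + b log(-τ)` and obeys the conservative profile equation there, then
`∂_τ E(y,τ) = -(-τ)^{a-1}(aG + bG')(η₀)` and `∂_y[2e^{y}E^{3/2}](y,τ) = (-τ)^{a-1}(aG + bG')(η₀)`: the ansatz solves
`∂_τ E + ∂_y(2e^{y}E^{3/2}) = 0` at `(y, τ)`.  (The exponent bookkeeping: `∂_τ E ∝ (-τ)^{a-1}`,
`∂_y f ∝ (-τ)^{3a/2 - b}`, equal iff `b = 1 + a/2`.)
[folklore (similarity solutions of a scalar conservation law); cell memo W1] -/
theorem similarity_ansatz {G : ℝ → ℝ} {a b g y τ : ℝ} (hτ : τ < 0) (hbal : b = 1 + a / 2)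
    (hG : HasDerivAt G g (y + b * log (-τ))) (hpos : 0 < G (y + b * log (-τ)))
    (hΦ : HasDerivAt (fun η => 2 * exp η * (G η * sqrt (G η)) - b * G η)
      (a * G (y + b * log (-τ))) (y + b * log (-τ))) :
    HasDerivAt (fun τ' => (-τ') ^ a * G (y + b * log (-τ')))
        (-((-τ) ^ (a - 1) * (a * G (y + b * log (-τ)) + b * g))) τ ∧
      HasDerivAt (fun y' => 2 * exp y' *
          (((-τ) ^ a * G (y' + b * log (-τ))) * sqrt ((-τ) ^ a * G (y' + b * log (-τ)))))
        ((-τ) ^ (a - 1) * (a * G (y + b * log (-τ)) + b * g)) y := by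
  set η₀ : ℝ := y + b * log (-τ) with hη₀
  have hs : 0 < -τ := by linarith
  have hprof := profile_nonconservative hG hpos hΦ
  -- powers of `-τ`
  have hpow2 : (-τ) ^ a * (-τ)⁻¹ = (-τ) ^ (a - 1) := by
    rw [Real.rpow_sub_one hs.ne']
    ring
  have hey : exp y = exp η₀ * (-τ) ^ (-b) := by
    rw [hη₀, Real.exp_add, Real.rpow_neg hs.le, Real.rpow_def_of_pos hs]
    rw [show b * log (-τ) = log (-τ) * b by ring]
    field_simp
  have hpow1 : exp y * (-τ) ^ (3 * a / 2) = exp η₀ * (-τ) ^ (a - 1) := by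
    rw [hey, mul_assoc, ← Real.rpow_add hs]
    congr 2
    rw [hbal]; ring
  have hss : sqrt (G η₀) * sqrt (G η₀) = G η₀ := mul_self_sqrt hpos.le
  have hkey : G η₀ * (g * 1 / (2 * sqrt (G η₀))) = sqrt (G η₀) * g / 2 := by
    field_simp
    rw [Real.sq_sqrt hpos.le]
    ring
  constructor
  · -- the `τ`-derivative at fixed `y`
    have hneg : HasDerivAt (fun τ' : ℝ => -τ') (-1) τ := (hasDerivAt_id τ).neg
    have hrp : HasDerivAt (fun τ' : ℝ => (-τ') ^ a) (-1 * a * (-τ) ^ (a - 1)) τ :=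
      hneg.rpow_const (Or.inl hs.ne')
    have hlog : HasDerivAt (fun τ' : ℝ => log (-τ')) (-1 / -τ) τ := hneg.log hs.ne'
    have hinner : HasDerivAt (fun τ' : ℝ => y + b * log (-τ')) (b * (-1 / -τ)) τ :=
      (hlog.const_mul b).const_add y
    have hGc : HasDerivAt (fun τ' : ℝ => G (y + b * log (-τ'))) (g * (b * (-1 / -τ))) τ :=
      hG.comp τ hinner
    have hE := hrp.mul hGc
    refine hE.congr_deriv ?_
    have h1 : (-1 : ℝ) / -τ = -((-τ)⁻¹) := by
      rw [neg_div_neg_eq, inv_neg, neg_neg, one_div]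
    rw [h1]
    linear_combination (-(g * b)) * hpow2
  · -- the `y`-derivative of the flux at fixed `τ`
    have hfun : (fun y' => 2 * exp y' *
          (((-τ) ^ a * G (y' + b * log (-τ))) * sqrt ((-τ) ^ a * G (y' + b * log (-τ))))) =
        fun y' => 2 * exp y' * ((-τ) ^ (3 * a / 2) *
          (G (y' + b * log (-τ)) * sqrt (G (y' + b * log (-τ))))) := by
      funext y'
      have h32 : (-τ) ^ a * sqrt ((-τ) ^ a) = (-τ) ^ (3 * a / 2) := by
        rw [Real.sqrt_eq_rpow, ← Real.rpow_mul hs.le, ← Real.rpow_add hs]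
        congr 1; ring
      rw [Real.sqrt_mul (Real.rpow_nonneg hs.le a), ← h32]
      ring
    rw [hfun]
    have hinner_y : HasDerivAt (fun y' : ℝ => y' + b * log (-τ)) 1 y := (hasDerivAt_id y).add_const _
    have hGy : HasDerivAt (fun y' : ℝ => G (y' + b * log (-τ))) (g * 1) y := hG.comp y hinner_y
    have hsq_y : HasDerivAt (fun y' : ℝ => sqrt (G (y' + b * log (-τ)))) (g * 1 / (2 * sqrt (G η₀))) y :=
      hGy.sqrt hpos.ne'
    have hGs_y := hGy.mul hsq_y
    have hflux := ((Real.hasDerivAt_exp y).const_mul 2).mul (hGs_y.const_mul ((-τ) ^ (3 * a / 2)))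
    refine hflux.congr_deriv ?_
    simp only [hη₀] at hkey hss hprof hpow1 ⊢
    simp only [Pi.mul_apply]
    linear_combination (2 * (G (y + b * log (-τ)) * sqrt (G (y + b * log (-τ)))) +
        3 * g * sqrt (G (y + b * log (-τ)))) * hpow1 +
      (2 * exp y * (-τ) ^ (3 * a / 2)) * hkey + ((-τ) ^ (a - 1)) * hprof

/-- **THE SELECTION THEOREM of the continuum limit (shock-free wakes).**  Let `G` be a similarity profile with
exponents `(a, b)`, `b > 0`, in the class `b = 1 + a/2`, that is: continuous on the wake `(-∞, η']`
behind a point `η'` where it is supersonic (`3e^{η'}√G(η') > b`, e.g. the Rankine–Hugoniot state of the leading front,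
`front_state_supersonic`), decaying like `e^{-γη}`, `γ < 2`, far back, and — the regularity that does the selecting —
DIFFERENTIABLE with `G > 0` and obeying the conservative profile equation `(2e^{η}G√G - bG)' = aG` at every interior
point of the wake.  Then `a = 1`, `b = 3/2` and the wake rate is `a/b = 2/3` (Kolmogorov), strictly above the (S₁)
threshold `2/5`.  Equivalently: continuum fronts with any other exponent have a sonic singularity (a second
discontinuity or a fold) inside the wake.
[folklore (self-similar solutions of the second kind, cf. Barenblatt 1979, Ch. 4); cell memo W1] -/
theorem similarity_exponent_selection {G : ℝ → ℝ} {a b C γ η₁ η' : ℝ} (hb : 0 < b) (hbal : b = 1 + a / 2)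
    (hcont : ContinuousOn G (Iic η')) (hsup : b < 3 * exp η' * sqrt (G η'))
    (hη₁ : η₁ ≤ η') (hC : 0 ≤ C) (hγ : γ < 2) (hdecay : ∀ η, η ≤ η₁ → G η ≤ C * exp (-γ * η))
    (hpos : ∀ η, η < η' → 0 < G η)
    (hode : ∀ η, η < η' → ∃ g : ℝ, HasDerivAt G g η ∧
      HasDerivAt (fun x => 2 * exp x * (G x * sqrt (G x)) - b * G x) (a * G η) η) :
    a = 1 ∧ b = 3 / 2 ∧ a / b = 2 / 3 ∧ (2 : ℝ) / 5 < a / b := by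
  obtain ⟨η₂, hη₂, hsub⟩ := wake_eventually_subsonic hC hγ hb hdecay
  have hle : η₂ ≤ η' := hη₂.trans hη₁
  obtain ⟨η₀, hη₀, hson⟩ :=
    exists_sonic_point hle (hcont.mono Icc_subset_Iic_self) (hsub η₂ le_rfl) hsup
  obtain ⟨g, hG, hΦ⟩ := hode η₀ hη₀.2
  have hsel := sonic_selection hG (hpos η₀ hη₀.2) hΦ hson
  obtain ⟨ha, hb', hγ'⟩ := exponents_of_sonic_selection hsel hbal
  exact ⟨ha, hb', hγ', by rw [hγ']; norm_num⟩

end SonicSelection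


section LatticeDictionary

open Literature.Analysis.FluidPDE Literature.Analysis.FluidPDE.TaoCascade

/-- **Lattice dictionary: (S₁)-survival of a DSS wave ⟺ its front-energy exponent lies in the NON-selected range
`0 < a ≤ 1/2`.**  A DSS wave with delay `T` passes shell `n` at `t⋆ - t = e^{-nT}` with front energy
`≍ μ^n = (t⋆-t)^{a}`, `a = 2 log Λ / T - 2` (`Λ = bigLam ε₀`, `μ = dssMu ε₀ T = e^{2T}/Λ²`); in this parametrisation
`Surviving 1 ε₀ T` (`(1+ε₀)^{-1} ≤ μ < 1`) reads `0 < a ≤ 1/2`, whereas the continuum sonic selection pins `a = 1`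
(`similarity_exponent_selection`; Kolmogorov, `μ = (1+ε₀)^{-5/3}`, `T = (2/3) log Λ`).
[cite: Tao2016AveragedNS, §4 (4.1) and the viscous equation before Thm. 4.2 (the weights behind `Surviving`); cell vocabulary; elementary] -/
theorem surviving_one_iff_frontExponent {ε₀ T : ℝ} (hε : 0 < ε₀) (hT : 0 < T) :
    Surviving 1 ε₀ T ↔
      0 < 2 * log (bigLam ε₀) / T - 2 ∧ 2 * log (bigLam ε₀) / T - 2 ≤ 1 / 2 := by
  have hb : 0 < 1 + ε₀ := by linarith
  have hL : log (bigLam ε₀) = 5 / 2 * log (1 + ε₀) := by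
    rw [bigLam, Real.log_rpow hb]
  have h5 : (0 : ℝ) < (1 + ε₀) ^ 5 := pow_pos hb 5
  unfold Surviving dssMu
  rw [hL]
  have e1 : (1 + ε₀) ^ (-(1 : ℝ)) ≤ exp (2 * T) / (1 + ε₀) ^ 5 ↔ 4 * log (1 + ε₀) ≤ 2 * T := by
    rw [le_div_iff₀ h5, Real.rpow_neg hb.le, Real.rpow_one]
    have h4 : (1 + ε₀)⁻¹ * (1 + ε₀) ^ 5 = (1 + ε₀) ^ 4 := by field_simp
    rw [h4, ← Real.log_le_iff_le_exp (pow_pos hb 4), Real.log_pow]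
    push_cast
    exact Iff.rfl
  have e2 : exp (2 * T) / (1 + ε₀) ^ 5 < 1 ↔ 2 * T < 5 * log (1 + ε₀) := by
    rw [div_lt_one h5, ← Real.lt_log_iff_exp_lt h5, Real.log_pow]
    push_cast
    exact Iff.rfl
  rw [e1, e2]
  have e3 : 0 < 2 * (5 / 2 * log (1 + ε₀)) / T - 2 ↔ 2 * T < 5 * log (1 + ε₀) := by
    rw [sub_pos, lt_div_iff₀ hT]
    constructor <;> intro h <;> linarith
  have e4 : 2 * (5 / 2 * log (1 + ε₀)) / T - 2 ≤ 1 / 2 ↔ 4 * log (1 + ε₀) ≤ 2 * T := by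
    rw [sub_le_iff_le_add, div_le_iff₀ hT]
    constructor <;> intro h <;> linarith
  rw [e3, e4]
  exact And.comm

end LatticeDictionary

end Summit.NavierStokesRegularity.NavierStokesRegularity.Theorems.NoSurvivingEternalViscBddOne.Continuum

end
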